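import Literature.AlgebraicGeometry.Resolution.RsopMonomialIdeals
import Mathlib.Algebra.CharP.Lemmas
import HarnessLib

/-!
# SatelliteAlgebra — decomp-res node «SatelliteCut» (lens-4 g28, critic row 164), tree file 1/5 of the node

Content VERBATIM from the decomp-res lens-4 g28 node `HOME/decomp-res-lens-4/g28/SatelliteCut.lean` (pin b83bf2f8 =
`parts/SatelliteCut-g28-b83bf2f8.lean`,
998 l; HOME = run/shared/lean/pub/decomp-res): ONE NEW PART §74–§77 = `parts/part_new-g28-3bc4b3a5.lean` (46
declarations), typed against the LANDED
tree (the node imports `Theorems/DepthCutCells` + `Theorems/MaxContactCutCompanionCut` only; nothing carried, nothing inlined).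
Critic: CRITIC-LEDGER row 164 (2026-08-31T01:23:24Z): CLEARED — DECIDED +1 · MAP 0 (the SATELLITE NO-JUMP LAW over
two consecutive blow-ups =
Hauser's kangaroo condition (3) in kernel, unconditional in the shallow prime-weight window; typed sub-cell `n.Prime
∧ SatelliteJumpTower n` of
`NoWildShallowCompanionKangarooTowers` EMPTY for every `n`; EXACT hypothesis-free re-location to
`NoWildFreeJumpShallowCompanionKangarooTowers`; entrances
on both sides; census cross-check T-satellite (census-1 g23, `HOME/census/it/kangsat/T-satellite.md` 2d03875b)
confirmed 2/2 · 33/33 · 0/88).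
Landing orders INBOX :651 (lens-4 g28 landing note, split per NEXT-g29 §3) and :659 (critic): `--kind proof
--supports stmt-ResolutionOfSingularities-28338`,
namespace `…Theorems.HugValuationCut`, canonical headers, one file per section (D-0064); files of the node:
`SatelliteAlgebra` (§74) · `SatelliteTransport` + `SatelliteTransport2` (§75) ·
`SatelliteCutCells` (§76–§77, cone-free cells: the aside home) · `MaxContactCutSatelliteCut` (the four §77
corollaries GIVEN 31571 `MaxContactCut.NoContactHuggingTowers`
BY NAME — in the Theses cone, kept apart so that the route file can import the aside home without an import cycle,
as for `DepthCutCells` / `MaxContactCutDepthCut`).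
Aside bookkeeping (row 164 / INBOX :659): ONE successor aside on the lens-4 column,
`NoWildFreeJumpShallowCompanionKangarooTowers` (home `SatelliteCutCells`),
SUPERSEDING g27's `NoWildShallowCompanionKangarooTowers` (exact hyp-free
`noWildShallowCompanionKangarooTowers_iff_g28`); the decided cell
`NoWildSatelliteJumpShallowTowers` is a THEOREM (`noWildSatelliteJumpShallowTowers_holds`) and is not filed.  TWO
TEXT FIXES at landing (docstrings only, ordered by
the critic, row 164 / INBOX :659; no statement or proof changed): (i) the hand inhabitant in the docstring of
`WildFreeJumpShallowCompanionKangarooTowersTerminate`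
is NODE-g28's isolated chain `Z² + U³ + U²T + T⁵ → z² + u²t + u³t + t³ → (z₁ + t)² + tv² + vt² + v²t² + v³t²` (the
lens text named a non-isolated polynomial);
(ii) the part's declaration count «42» → 46.

The lens header, verbatim:

> # SatelliteCut — decomp-res-lens-4 g28 «SatelliteCut» (lens: minimal counterexample / extremal reduction)
>
> NODE g28 of the lens-4 chain (HugValuationCut g21 → … → CompanionCut g26 → AntelopeCut g27 → SatelliteCut g28).
TARGET = g27's
> located residual `NoWildShallowCompanionKangarooTowers` (wild · off-locus singular class · `p`-power form at every
marked point ·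
> weight-`n` kangaroo-recurrent · companion-recurrent · SHALLOW).  The critic's g28 window (CRITIC-LEDGER row 157):
the one-blow-up
> depth/height/dimension lever is SPENT; the next `+1` is a KERNEL LAW ALONG THE TOWER in which the RECURRENCE /
JUMP letters or TWO
> CONSECUTIVE BLOW-UPS are load-bearing, killing a TYPED sub-cell with an EXACT hypothesis-free re-location.
>
> THE LAW OF THIS NODE — «NO KANGAROO JUMP AT A SATELLITE POINT» (§75–§76, KERNEL, PROVED, weight = characteristic = `p`, EVERY
> field, no perfectness): along a `p`-power forced tower of weight `p`, let stage `i` carry PRINCIPAL weak contact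
along a regular
> hypersurface germ `H` (`𝓘_i ⊆ (f) + 𝔪^{2p}`, `f ≡ c·z^p mod 𝔪^{p+1}`), let stage `i + 1` be JUMP-FREE along the
strict transform
> `H'`, and let the marked point `x_{i+2}` be a SATELLITE point of the second blow-up — a point of the strict transform of the
> exceptional divisor `E_{i+1} = π_i^{-1}(x_i)`.  THEN stage `i + 2` is jump-free along `H''` (`wInv_of_satellite_window`);
> contrapositively, A KANGAROO JUMP TWO STAGES AFTER A PRINCIPAL STAGE HAPPENS AT A FREE POINT
(`jump_point_is_free`).  This is the
> forced-tower form of Hauser's kangaroo condition (3) [arXiv:0811.4151 §C, Kangaroo Theorem (3): «a' lies on none of the strict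
> transforms of the exceptional components with r_i ≢ 0 mod p»; Hauser, Bull. AMS 47 (2010) p. 17–18, remark (b)]
for the TREE's jump
> notion (loss of weak contact along the transported hypersurface, g24 `EventuallyJumpFree`) — and here it needs NO residue
> condition and NO shallowness: one jump-free blow-up after a principal stage the tail is divisible by the exceptional parameter
> WHATEVER its multiplicity, and divisibility by two independent parameters is incompatible with a non-zero `p`-power form of
> degree `p`.  MECHANISM (two consecutive blow-ups load-bearing): (S1 `eTail_point_transport`) the transported
> presentation REMEMBERS the exceptional factor — after one jump-free point blow-up some `w₁ ∈ 𝓘'_y` has `w₁ − c'z'^p ∈ (t) ∩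
> 𝔪^{p+1}` with `(t, z')` JOINT regular parameters (`point_round_chart_rsop`: both are members of the chart's
regular system; the
> re-witnessing uses the transported principality `𝓘'_y ⊆ (w₀) + (t^p)` and LEMMA Z `mem_maximalIdeal_of_rsopPair`:
a unit multiple
> of `z'^p` never lies in `(t) + 𝔪^{p+1}`); (S2 `wInv_of_eTail_satellite`) at the next blow-up the tail becomes `s'·t₁·g₁` with
> `(s') = E_new`, `t₁` = the strict transform of `E_old`; at a SATELLITE point `t₁ ∈ 𝔪`, so `(s', t₁)` are joint
regular parameters,
> and LEMMA D `mem_pow_succ_of_rsopPair_pPowerSpan` (an element of `(s'·t₁)` whose degree-`p` initial form is a `p`-POWER FORM —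
> `PPowerTower` — lies in `𝔪^{p+1}`: the monomial `x_j^p` needed for a translational jump `z ↦ z + γx_j` is absent) gives weak
> contact at the satellite point along `H''`, the SAME transported hypersurface.
>
> THE CUT (§77): typed sub-cell `SatelliteJumpTower n T` (∃ stage `i`, germ `H`: `PWInv` at `i`, `WInv` at `i+1`
along `H'`, `x_{i+2}`
> on the strict transform of `E_{i+1}`, `¬WInv` at `i+2` along `H''`); DECIDED cell = g27 residual ∧ (`n` prime ∧
`SatelliteJumpTower
> n`) — EMPTY for every `n` over every field (`wildSatelliteJumpShallow_holds`: `p ∣ n`, `n` prime ⇒ `p = n`, then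
the law); LOCATED
> RESIDUAL = g27 residual ∧ ¬(`n` prime ∧ `SatelliteJumpTower n`) =:
`WildFreeJumpShallowCompanionKangarooTowersTerminate n`, by name
> `NoWildFreeJumpShallowCompanionKangarooTowers`; EXACT hypothesis-free re-locations `wildShallowCompanionKangaroo_iff_g28`,
> `noWildShallowCompanionKangarooTowers_iff_g28`, `noWildCompanionKangarooTowers_iff_g28`, and GIVEN 31571 (`h71`)
the whole aside
> chain down to the tree aside 28338 (`noWildContactFreeOffLocusTowers_iff_g28`).
>
> INHABITANTS (by hand, char 2, weight 2, ring dimension 3 — both sides of the cut are entered by census-type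
chains).  DECIDED side
> (the configuration «principal → no jump → satellite» occurs and the law forbids the jump): `z² + u³ + v⁵` →
(`v`-chart, origin)
> `z'² + u'³v + v³` (principal, no jump, tail `∈ (v)`) → (`u'`-chart, origin = the satellite point `E₂ ∩ E₁'`) `z''²
+ u'²v'' + u'v''³`
> — no jump, order 2 isolated at each step.  RESIDUAL side (a FREE jump): `Z² + U³ + U²T + T⁵` → (`T`-chart, origin)
`z² + u²t + u³t + t³`
> (on `E₁ = V(t)`, no jump, tail `∈ (t)`) → (`t`-chart, the point `u/t = 1` of `E₂`, OFF the strict transform of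
`E₁`, which is empty
> in this chart) `(z₁ + t)² + tv² + vt² + v²t² + v³t²` (`v = u/t − 1`): weak contact along `z₁` is LOST and regained
along `z₁ + t` —
> a jump at a FREE point, by the NEW exceptional letter `t²`, exactly as the law allows; order 2 isolated at each of
the three points
> (Hasse derivatives: `U², U² + T⁴`; `tu², u² + t² + u³`; `t²(1 + v²), v²`).  CENSUS
(HOME/census/it/kangjump/T-kangO-jump.md, desk,
> 382 weight-`p` wild off-locus chains): 33 chains jump, each exactly ONCE, at stage 1 (31) or stage 2 (2), and
EVERY recorded jump
> is `in_p(f_{j+1}) = y^p + λ·x_c^p` with `x_c` the EXCEPTIONAL coordinate of the move — the shadow of S2's first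
factor (the tail is
> divisible by the new exceptional parameter); the law predicts that the 2 stage-2 jump nodes are FREE points of their second
> blow-up (desk fold asked, NEXT-g29 §2).
> DELIMITERS: (i) PRIME WEIGHT ONLY — at composite weight `n = 4`, `p = 2` the monomial `s²t₁²` IS a `p`-power form,
LEMMA D is void,
> and the decided cell is typed `n.Prime ∧ …` accordingly; (ii) the law sees ONE previous component (`E_{i+1}`):
jumps at points of
> transforms of OLDER components `E_j`, `j ≤ i`, are not excluded by this node (their residues need the boundary
vector — NEXT-g29);
> (iii) principality at stage `i` (`PWInv`) is needed for the re-witnessing of S1 (it holds at every stage that is a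
hypersurface
> point of an order-`p` `p`-power germ, in particular along all census chains).
>
> NO CARRY: g27's §71–§73 (`AntelopeCut.lean`) LANDED during this session as `Theorems/DepthLawAlgebra` · `DepthLaw` ·
> `AntelopeDictionary` · `DepthCutCells` (2026-08-31T00:35–00:51Z) and are IMPORTED; g26's in-cone wiring
`MaxContactCutCompanionCut`
> supplies the `h71` re-locations down to the tree aside.  This file is ONE NEW PART §74–§77 (46 declarations): 0
sorry · axioms ⊆
> {propext, Classical.choice, Quot.sound} · no `instance` · no `notation` · every field (no perfectness anywhere).

## This file

§74 (NEW, KERNEL, pure algebra) TWO LETTERS OF A REGULAR SYSTEM OF PARAMETERS — `section SatelliteAlgebra` (10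
lemmas in a local ring with a pair that is PART OF ONE regular system of parameters, `IsRsopPart ![t, z]`):
`sup_span_singleton_pow_le`, `mem_maximalIdeal_of_mul_pow_mem_sup` (coefficient extraction along a prime
co-parameter ideal), `isRsopPart_of_span_eq`, `isRsopPart_of_range_eq`, `rsop_drop`, `coeff_mem_maximalIdeal`, LEMMA
Z **`mem_maximalIdeal_of_rsopPair`** (`δ·z^n ∈ (t) + 𝔪^{n+1}` ⟹ `δ ∈ 𝔪`), Frobenius `pow_char_mem_span_pow`, LEMMA D
**`mem_pow_succ_of_rsopPair_pPowerSpan`** (characteristic `p`: an element of `(a·b)` lying in the `p`-power span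
`⟨h^p : h ∈ S⟩ + 𝔪^{p+1}`, `S ⊆ 𝔪`, lies in `𝔪^{p+1}`), `mem_pow_of_mul_mem_pow_succ`.  Imports Literature
`RsopMonomialIdeals` (the `IsRsopPart` API, hence `RegularLocalOrder`) + Mathlib `CharP.Lemmas` only.

[WRITER NOTE (decomp-res writer g10): file split only (tree files ≤ 400 lines); namespace, universes, sections,
section variables and every declaration
exactly as in the lens (the node's global `set_option` and the `open …Theses` line live only in the wiring file; the
pure-algebra file opens only what it uses).]

(Sources: Hauser2010Kangaroo (arXiv:0811.4151 p. 6, Kangaroo Theorem condition (3) + remark (a)); HauserPerlega2019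
§2; Hauser2024 PRIMS 60; Moh1987; Matsumura1987 Thms. 14.2–14.3; ZariskiSamuel1960 VIII §11; StacksProject Tag 00NQ;
CossartPiltant2008 §2; Giraud1975.)
-/

noncomputable section

open IsLocalRing
open Literature.AlgebraicGeometry.Resolution
open scoped BigOperators

namespace Summit.ResolutionOfSingularities.ResolutionOfSingularities.Theorems.HugValuationCut

section SatelliteAlgebra

universe uS
variable {R : Type uS} [CommRing R]

/-! ## §74 (g28 · NEW · KERNEL, pure algebra) TWO LETTERS OF A REGULAR SYSTEM OF PARAMETERS: LEMMA Z and LEMMA D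

In a local ring `R` with a pair `(t, z)` that is PART OF ONE REGULAR SYSTEM OF PARAMETERS (`IsRsopPart ![t, z]`):
LEMMA Z (`mem_maximalIdeal_of_rsopPair`): `δ·z^n ∈ (t) + 𝔪^{n+1}` ⟹ `δ ∈ 𝔪` — via the prime co-parameter ideal `P =
(x_i : i ≠ j)`
of a full regular system (`rsop_drop`: `P` prime, `x_j ∉ P`, `P + (x_j) = 𝔪`, hence `𝔪^{n+1} ⊆ P + (x_j^{n+1})`);
LEMMA D (`mem_pow_succ_of_rsopPair_pPowerSpan`, characteristic `p`): an element of `(a·b)` (`(a, b)` a regular pair)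
lying in the
`p`-POWER SPAN `⟨h^p : h ∈ S⟩ + 𝔪^{p+1}` (`S ⊆ 𝔪`) lies in `𝔪^{p+1}` — Frobenius linearity `(Σ cᵢxᵢ)^p = Σ cᵢ^p
xᵢ^p` puts the span
inside `(x₁^p, …, x_d^p) + 𝔪^{p+1}`, and a multiple of `a·b = x₀x₁` has every coefficient on `x_i^p` in `𝔪` (LEMMA Z letter by
letter).  (Sources: Matsumura1987, Thms. 14.2–14.3; ZariskiSamuel1960, VIII §11; StacksProject, Tag 00NQ.) -/

/-- `(P + (x))^m ≤ P + (x^m)`. [folklore] -/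
theorem sup_span_singleton_pow_le (P : Ideal R) (x : R) (m : ℕ) :
    (P ⊔ Ideal.span {x}) ^ m ≤ P ⊔ Ideal.span {x ^ m} := by
  induction m with
  | zero => simp
  | succ m ih =>
    rw [pow_succ]
    refine (Ideal.mul_mono_left ih).trans ?_
    rw [Ideal.sup_mul, Ideal.mul_sup, Ideal.mul_sup, Ideal.span_singleton_mul_span_singleton, ← pow_succ]
    exact sup_le (sup_le (Ideal.mul_le_right.trans le_sup_left) (Ideal.mul_le_right.trans le_sup_left))
      (sup_le (Ideal.mul_le_left.trans le_sup_left) le_sup_right)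

/-- **Coefficient extraction along a prime co-parameter ideal.** `R` local, `P` prime, `x ∉ P`, `P + (x) = 𝔪`:
`δ·x^n ∈ P + 𝔪^{n+1}` forces `δ ∈ 𝔪` (write `𝔪^{n+1} ⊆ P + (x^{n+1})`, cancel `x^n` modulo the prime `P`). [folklore] -/
theorem mem_maximalIdeal_of_mul_pow_mem_sup [IsLocalRing R] {P : Ideal R} (hP : P.IsPrime) {x : R} (hx : x ∉ P)
    (hm : P ⊔ Ideal.span {x} = maximalIdeal R) {δ : R} {n : ℕ}
    (h : δ * x ^ n ∈ P ⊔ maximalIdeal R ^ (n + 1)) : δ ∈ maximalIdeal R := by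
  have h1 : δ * x ^ n ∈ P ⊔ Ideal.span {x ^ (n + 1)} := by
    have hle : P ⊔ maximalIdeal R ^ (n + 1) ≤ P ⊔ Ideal.span {x ^ (n + 1)} := by
      refine sup_le le_sup_left ?_
      rw [← hm]
      exact sup_span_singleton_pow_le P x (n + 1)
    exact hle h
  obtain ⟨a, ha, b, hb, hab⟩ := Submodule.mem_sup.mp h1
  obtain ⟨r, rfl⟩ := Ideal.mem_span_singleton'.mp hb
  have h2 : x ^ n * (δ - r * x) ∈ P := by
    have e : x ^ n * (δ - r * x) = a := by
      have : a = δ * x ^ n - r * x ^ (n + 1) := by rw [← hab]; ring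
      rw [this]; ring
    rw [e]; exact ha
  rcases hP.mem_or_mem h2 with h3 | h3
  · exact absurd (hP.mem_of_pow_mem n h3) hx
  · have h4 : δ = (δ - r * x) + r * x := by ring
    rw [← hm, h4]
    exact add_mem (Ideal.mem_sup_left h3) (Ideal.mem_sup_right (Ideal.mul_mem_left _ r (Ideal.mem_span_singleton_self x)))

/-- a minimal basis of `𝔪` of length `emb dim R` in a regular local ring is a (full) regular system of parameters.
(Sources: Matsumura1987, Thm. 14.2.) -/
theorem isRsopPart_of_span_eq [IsRegularLocalRing R] {d : ℕ} {x : Fin d → R}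
    (hd : (maximalIdeal R).spanFinrank = d) (hx : Ideal.span (Set.range x) = maximalIdeal R) : IsRsopPart x := by
  refine ⟨inferInstance, 0, Fin.elim0, ?_, ?_⟩
  · rw [← IsRegularLocalRing.spanFinrank_maximalIdeal (R := R), hd, Nat.add_zero]
  · have hr : Set.range (Fin.elim0 : Fin 0 → R) = ∅ := Set.range_eq_empty _
    rw [hr, Set.union_empty, hx]

/-- `IsRsopPart` depends on the family only through its length and its range. [folklore] -/
theorem isRsopPart_of_range_eq [IsLocalRing R] {n m : ℕ} {z : Fin n → R} {z' : Fin m → R} (h : IsRsopPart z)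
    (hnm : n = m) (hr : Set.range z' = Set.range z) : IsRsopPart z' := by
  subst hnm
  obtain ⟨hR, e, y, hdim, hs⟩ := h
  exact ⟨hR, e, y, hdim, by rw [hr]; exact hs⟩

/-- **Dropping one member of a full regular system of parameters**: the ideal of the others is PRIME, misses the dropped
member, and together with it spans `𝔪`. (Sources: Matsumura1987, Thm. 14.3.) -/
theorem rsop_drop [IsLocalRing R] {d : ℕ} {x : Fin d → R} (hx : IsRsopPart x)
    (hfull : Ideal.span (Set.range x) = maximalIdeal R) (j : Fin d) :
    (Ideal.span (x '' {i | i ≠ j})).IsPrime ∧ x j ∉ Ideal.span (x '' {i | i ≠ j}) ∧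
      Ideal.span (x '' {i | i ≠ j}) ⊔ Ideal.span {x j} = maximalIdeal R := by
  classical
  refine ⟨?_, hx.not_mem_span_image (S := {i | i ≠ j}) (i := j) (by simp), ?_⟩
  · -- enumerate `{i | i ≠ j}` injectively by a `Fin`
    let g : Fin (Fintype.card {i : Fin d // i ≠ j}) → Fin d := fun a => ((Fintype.equivFin _).symm a).1
    have hg : Function.Injective g := fun a b hab =>
      (Fintype.equivFin _).symm.injective (Subtype.ext hab)
    have hrange : Set.range (x ∘ g) = x '' {i | i ≠ j} := by
      ext a
      constructor
      · rintro ⟨b, rfl⟩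
        exact ⟨g b, ((Fintype.equivFin _).symm b).2, rfl⟩
      · rintro ⟨i, hi, rfl⟩
        refine ⟨Fintype.equivFin _ ⟨i, hi⟩, ?_⟩
        simp only [Function.comp_apply, g, Equiv.symm_apply_apply]
    rw [← hrange]
    exact (hx.comp g hg).isPrime_span_range
  · rw [← Ideal.span_union, ← hfull]
    congr 1
    ext a
    constructor
    · rintro (⟨i, -, rfl⟩ | rfl)
      · exact ⟨i, rfl⟩
      · exact ⟨j, rfl⟩
    · rintro ⟨i, rfl⟩
      by_cases hij : i = j
      · subst hij; exact Or.inr rfl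
      · exact Or.inl ⟨i, hij, rfl⟩

/-- **Coefficient extraction in a full regular system of parameters**: `δ·x_j^n ∈ (x_i : i ≠ j) + 𝔪^{n+1} ⟹ δ ∈ 𝔪`.
(Sources: Matsumura1987, Thm. 14.3.) -/
theorem coeff_mem_maximalIdeal [IsLocalRing R] {d : ℕ} {x : Fin d → R} (hx : IsRsopPart x)
    (hfull : Ideal.span (Set.range x) = maximalIdeal R) (j : Fin d) {δ : R} {n : ℕ}
    (h : δ * x j ^ n ∈ Ideal.span (x '' {i | i ≠ j}) ⊔ maximalIdeal R ^ (n + 1)) : δ ∈ maximalIdeal R := by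
  obtain ⟨hP, hxj, hm⟩ := rsop_drop hx hfull j
  exact mem_maximalIdeal_of_mul_pow_mem_sup hP hxj hm h

/-- **LEMMA Z (re-witnessing modulo an exceptional parameter).** If `(t, z)` is part of a regular system of parameters then
`δ·z^n ∈ (t) + 𝔪^{n+1}` forces `δ ∈ 𝔪`: a UNIT multiple of `z^n` is never `≡ 0 (mod t, 𝔪^{n+1})`. (Sources:
Matsumura1987, Thm. 14.3.) -/
theorem mem_maximalIdeal_of_rsopPair [IsLocalRing R] {t z : R} (h : IsRsopPart ![t, z]) {δ : R} {n : ℕ}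
    (hδ : δ * z ^ n ∈ Ideal.span {t} ⊔ maximalIdeal R ^ (n + 1)) : δ ∈ maximalIdeal R := by
  haveI := h.isRegularLocalRing
  obtain ⟨e, x, hd, hfull, hx0⟩ := h.exists_rsop
  have hxr : IsRsopPart x := isRsopPart_of_span_eq hd hfull
  have hx1 : x (Fin.castAdd e 1) = z := by rw [hx0]; rfl
  have hx0' : x (Fin.castAdd e 0) = t := by rw [hx0]; rfl
  have hne : Fin.castAdd e (0 : Fin 2) ≠ Fin.castAdd e 1 := fun h' => by
    have := Fin.castAdd_injective 2 e h'
    exact absurd this (by decide)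
  refine coeff_mem_maximalIdeal hxr hfull (Fin.castAdd e 1) (n := n) ?_
  rw [hx1]
  have hle : Ideal.span {t} ⊔ maximalIdeal R ^ (n + 1) ≤
      Ideal.span (x '' {i | i ≠ Fin.castAdd e 1}) ⊔ maximalIdeal R ^ (n + 1) := by
    refine sup_le_sup_right ?_ _
    rw [Ideal.span_singleton_le_iff_mem, ← hx0']
    exact Ideal.subset_span ⟨Fin.castAdd e 0, hne, rfl⟩
  exact hle hδ

/-- Frobenius: in characteristic `p`, the `p`-th power of an element of `𝔪 = (x₁, …, x_d)` lies in `(x₁^p, …,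
x_d^p)`. [folklore] -/
theorem pow_char_mem_span_pow (p : ℕ) [Fact p.Prime] [CharP R p] [IsLocalRing R] {d : ℕ} {x : Fin d → R}
    (hfull : Ideal.span (Set.range x) = maximalIdeal R) {h : R} (hh : h ∈ maximalIdeal R) :
    h ^ p ∈ Ideal.span (Set.range fun i => x i ^ p) := by
  rw [← hfull] at hh
  obtain ⟨c, hc⟩ := Ideal.mem_span_range_iff_exists_fun.mp hh
  haveI : ExpChar R p := ExpChar.prime (Fact.out : p.Prime)
  rw [← hc, sum_pow_char p]
  refine Ideal.sum_mem _ fun i _ => ?_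
  rw [mul_pow]
  exact Ideal.mul_mem_left _ _ (Ideal.subset_span ⟨i, rfl⟩)

/-- **LEMMA D (diagonal `p`-forms miss products of two parameters).** In characteristic `p`, if `(a, b)` is part of a regular
system of parameters and `g = a·b·q` lies in `⟨h^p : h ∈ S⟩ + 𝔪^{p+1}` for some `S ⊆ 𝔪`, then `g ∈ 𝔪^{p+1}`: modulo
`𝔪^{p+1}` the ideal of `p`-th powers is `(x₁^p, …, x_d^p)`, and the coefficient of each `x_j^p` is read modulo the PRIME
`(x_i : i ≠ j) ∋ g`. (Sources: Matsumura1987, Thm. 14.3.) -/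
theorem mem_pow_succ_of_rsopPair_pPowerSpan (p : ℕ) [Fact p.Prime] [CharP R p] [IsLocalRing R] {a b : R}
    (h : IsRsopPart ![a, b]) {S : Set R} (hS : S ⊆ maximalIdeal R) {q g : R} (hg : g = a * b * q)
    (hmem : g ∈ Ideal.span ((fun h : R => h ^ p) '' S) ⊔ maximalIdeal R ^ (p + 1)) :
    g ∈ maximalIdeal R ^ (p + 1) := by
  classical
  haveI := h.isRegularLocalRing
  obtain ⟨e, x, hd, hfull, hx0⟩ := h.exists_rsop
  have hxr : IsRsopPart x := isRsopPart_of_span_eq hd hfull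
  have hxa : x (Fin.castAdd e 0) = a := by rw [hx0]; rfl
  have hxb : x (Fin.castAdd e 1) = b := by rw [hx0]; rfl
  have hne : Fin.castAdd e (0 : Fin 2) ≠ Fin.castAdd e 1 := fun h' => by
    have := Fin.castAdd_injective 2 e h'
    exact absurd this (by decide)
  -- the ideal of diagonal `p`-forms
  set D : Ideal R := Ideal.span (Set.range fun i => x i ^ p) with hD
  have hSD : Ideal.span ((fun h : R => h ^ p) '' S) ≤ D := by
    rw [Ideal.span_le]
    rintro _ ⟨h', hh', rfl⟩
    exact pow_char_mem_span_pow p hfull (hS hh')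
  obtain ⟨δ, hδ, m, hm, hδm⟩ := Submodule.mem_sup.mp ((sup_le_sup_right hSD _) hmem)
  obtain ⟨μ, hμ⟩ := Ideal.mem_span_range_iff_exists_fun.mp hδ
  -- `g` lies in every co-parameter prime
  have hgP : ∀ j : Fin (2 + e), g ∈ Ideal.span (x '' {i | i ≠ j}) := by
    intro j
    rw [hg]
    by_cases hj : j = Fin.castAdd e 0
    · refine Ideal.mul_mem_right _ _ (Ideal.mul_mem_left _ _ ?_)
      rw [← hxb]
      exact Ideal.subset_span ⟨Fin.castAdd e 1, fun h' => hne (h'.trans hj).symm, rfl⟩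
    · refine Ideal.mul_mem_right _ _ (Ideal.mul_mem_right _ _ ?_)
      rw [← hxa]
      exact Ideal.subset_span ⟨Fin.castAdd e 0, fun h' => hj h'.symm, rfl⟩
  -- every coefficient is a non-unit
  have hμm : ∀ j, μ j ∈ maximalIdeal R := by
    intro j
    refine coeff_mem_maximalIdeal hxr hfull j (n := p) ?_
    have hsplit : μ j * x j ^ p = (g - m) - ∑ i ∈ Finset.univ.erase j, μ i * x i ^ p := by
      rw [← hδm, ← hμ, ← Finset.add_sum_erase Finset.univ (fun i => μ i * x i ^ p) (Finset.mem_univ j)]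
      ring
    rw [hsplit]
    refine sub_mem (sub_mem (Ideal.mem_sup_left (hgP j)) (Ideal.mem_sup_right hm)) (Ideal.mem_sup_left ?_)
    refine Ideal.sum_mem _ fun i hi => Ideal.mul_mem_left _ _ (Ideal.pow_mem_of_mem _ ?_ p (Fact.out : p.Prime).pos)
    exact Ideal.subset_span ⟨i, (Finset.mem_erase.mp hi).1, rfl⟩
  have hδ' : δ ∈ maximalIdeal R ^ (p + 1) := by
    rw [← hμ]
    refine Ideal.sum_mem _ fun i _ => ?_
    rw [pow_succ']
    exact Ideal.mul_mem_mul (hμm i) (Ideal.pow_mem_pow (by rw [← hfull]; exact Ideal.subset_span ⟨i, rfl⟩) p)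
  rw [← hδm]
  exact add_mem hδ' hm

/-- order is additive along a regular parameter: `t ∉ 𝔪²`, `t·g ∈ 𝔪^{n+1}` ⟹ `g ∈ 𝔪^n` (regular local ring).
(Sources: ZariskiSamuel1960, Ch. VIII §1 Thm. 1.) -/
theorem mem_pow_of_mul_mem_pow_succ [IsRegularLocalRing R] {t g : R} (ht : t ∉ maximalIdeal R ^ 2) {n : ℕ}
    (h : t * g ∈ maximalIdeal R ^ (n + 1)) : g ∈ maximalIdeal R ^ n := by
  by_contra hg
  cases n with
  | zero => exact hg (by simp)
  | succ q =>
    have h1 := mul_not_mem_pow_of_not_mem_pow (p := 1) (q := q) ht hg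
    rw [show 1 + q + 1 = q + 1 + 1 by ring] at h1
    exact h1 h

end SatelliteAlgebra

end Summit.ResolutionOfSingularities.ResolutionOfSingularities.Theorems.HugValuationCut
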